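import Summits.BirchSwinnertonDyer.Rank1Residual.X11b.KolyvaginH44Localized
import Summits.BirchSwinnertonDyer.BirchSwinnertonDyer.Theorems.SylvesterTwoHeegnerIndexUpperOffV0H44CoreSupersingular
import HarnessLib

/-!
# K7t crux `UpperOffV0HSYPlus` (item 19804), line `offv0-kolyvagin2`, the `2`-adic local clause `h44`,
# layer 2: x11b3's localized END (`h44_of_prop37_on` / `_of_dvd`) at SUPERSINGULAR Kolyvagin primes

Helper file of route `SylvesterTwoHeegnerIndex` (cell bsd-cm, rung K7t): x11b3's
`KolyvaginH44.h44_of_prop37_on` and `h44_of_prop37_of_dvd` (`X11b/KolyvaginH44Localized`) token for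
token, with `(hp2 : p ≠ 2) (hW : exists_weilPairing p)` replaced by the labelled input
`hss` («`a_ℓ(W) = 0` at every Kolyvagin prime of level `p^M`») and the core call replaced by k7t-c2 g6's
`h44_of_prop37_of_ringClassDecomposition_on_of_supersingular`.  Pass-through plumbing (x11b3's text,
credited there); `h37` / `h44` NOT discharged; no definition, no named fact, no `sorry`; B14 = O12 open
as a class; BSD not claimed.  References: [GrossLMS1991] Prop. 3.7; [McCallumLMS1991] Prop. 4.4.
-/

set_option autoImplicit false
set_option linter.dupNamespace false

noncomputable section

open scoped Classical
open WeierstrassCurve Field NumberField IsDedekindDomain Finset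
open Literature.NumberTheory.EllipticCurves Literature.NumberTheory.GaloisRepresentations
open Literature.NumberTheory.EllipticCurves.KolyvaginCocycle
open Literature.NumberTheory.EllipticCurves.KolyvaginEuler
open Summit.BirchSwinnertonDyer.Rank1Residual.X11b
open Summit.BirchSwinnertonDyer.Rank1Residual.X11b.KolyvaginH44

namespace Summit.BirchSwinnertonDyer.BirchSwinnertonDyer.Theorems.SylvesterTwoUpper

-- `K : Type`: the tree's ring-class class field theory is universe `0`.
variable {K : Type} [Field K] [NumberField K] {N : ℕ} {W : WeierstrassCurve ℚ}

/-- **`h44` at the levels `R` from Gross's Prop. 3.7 and the Galois dictionary, at SUPERSINGULAR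
Kolyvagin primes, any prime `p`** (x11b3's `h44_of_prop37_on`, `hp2`/`hW` → `hss`).
[cite: GrossLMS1991, Prop. 3.7, §3 p. 218 l. 1] [cite: McCallumLMS1991, Prop. 4.4, §4 (p. 282 l. 1)] -/
theorem h44_of_prop37_on_of_supersingular [NeZero N] [W.IsElliptic] [W.IsGloballyMinimal]
    (hK : IsImaginaryQuadratic K) (ι : K →+* ℂ)
    {P : (W.baseChange K).toAffine.Point} (hHP : IsHeegnerPoint N W K P)
    {p M : ℕ} (hp : p.Prime) (hM : 1 ≤ M)
    (hss : ∀ ℓ : ℕ, IsKolyvaginPrime N W K p ℓ → FrobEqFrobInfty W K (p ^ M) ℓ →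
      W.frobeniusTrace ℓ = 0)
    (hdiv : ∀ Q : geomPoints (W.baseChange K), ∃ R, ((p ^ M : ℕ) : ℤ) • R = Q)
    {𝒢 : ℕ → Type*} [∀ m, CommGroup (𝒢 m)] {A₀ : ℕ → Type*} [∀ m, AddCommGroup (A₀ m)]
    [∀ m, DistribMulAction (𝒢 m) (A₀ m)]
    (σ : ∀ m, ℕ → 𝒢 m) (L : ℕ → Finset ℕ) (H : ∀ m, Subgroup (𝒢 m))
    [∀ m, Fintype (𝒢 m ⧸ H m)] (f : ∀ m, 𝒢 m ⧸ H m → 𝒢 m)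
    (hord : ∀ m, ∀ ℓ ∈ L m, σ m ℓ ^ (ℓ + 1) = 1)
    (y : ∀ m, A₀ m)
    (π : ∀ m, absoluteGaloisGroup K →* 𝒢 m) (j : ∀ m, A₀ m →+ geomPoints (W.baseChange K))
    (hj : ∀ m (g : absoluteGaloisGroup K) (a : A₀ m), j m (π m g • a) = g • j m a)
    (hA : ∀ m, IsAdmissible (absoluteGaloisGroup K) (j m).range ((p ^ M : ℕ) : ℤ))
    (hPt : ∀ m, j m (kolyvaginPoint (σ m) (L m) (f m) (y m)) ∈
      invPoints (absoluteGaloisGroup K) (j m).range ((p ^ M : ℕ) : ℤ))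
    (hI : ∀ m : ℕ, ∀ v : HeightOneSpectrum (𝓞 K), (m : 𝓞 K) ∉ v.asIdeal →
      ∀ 𝔐 ∈ v.localPrimesAbove, ∀ t ∈ 𝔐.inertia (absoluteGaloisGroup (v.adicCompletion K)),
        resGal (K := K) (v.adicCompletion K) t • j m (kolyvaginPoint (σ m) (L m) (f m) (y m)) =
          j m (kolyvaginPoint (σ m) (L m) (f m) (y m)))
    (R : ℕ → Prop)
    (h37 : ∀ m : ℕ, R m → Squarefree m →
      (∀ q ∈ m.primeFactors, IsKolyvaginPrime N W K p q ∧ FrobEqFrobInfty W K (p ^ M) q) →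
      ∀ ℓ : ℕ, ℓ.Prime → ℓ ∣ m →
      ℓ ∈ L m ∧ ∃ y' : A₀ m,
        j m (kolyvaginPoint (σ m) ((L m).erase ℓ) (f m) y') =
          j (m / ℓ) (kolyvaginPoint (σ (m / ℓ)) (L (m / ℓ)) (f (m / ℓ)) (y (m / ℓ))) ∧
        grAct (A₀ m) (traceElt (σ m ℓ) ℓ) (y m) = W.frobeniusTrace ℓ • y' ∧
        ∀ [Fact ℓ.Prime] (hΔ : ¬ (ℓ : ℤ) ∣ minimalDiscriminantInt W)
          (φ₀ : absoluteGaloisGroup (ZMod ℓ)), (∀ x : AlgebraicClosure (ZMod ℓ), φ₀ • x = x ^ ℓ) →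
          ∀ γ : 𝒢 m, geomReduction hΔ ((RatClosure.pointsEquiv (K := K) W).symm (j m (γ • y m))) =
            φ₀ • geomReduction hΔ ((RatClosure.pointsEquiv (K := K) W).symm (j m (γ • y'))))
    (e : ∀ m, ringClassField K ι m →ₐ[K] AlgebraicClosure K)
    (ρ : ∀ m, 𝒢 m →* (ringClassField K ι m ≃ₐ[ℚ] ringClassField K ι m))
    (hρ : ∀ m, Function.Injective (ρ m))
    (hπρ : ∀ m (τ : absoluteGaloisGroup K) (x : ringClassField K ι m),
      τ • e m x = e m (ρ m (π m τ) x))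
    (hσρ : ∀ m : ℕ, R m → ∀ ℓ ∈ m.primeFactors,
      (Subgroup.zpowers (σ m ℓ)).map (ρ m) = ringClassGalOver ι m (m / ℓ)) :
    ∀ m : ℕ, R m → Squarefree m →
      (∀ q ∈ m.primeFactors, IsKolyvaginPrime N W K p q ∧ FrobEqFrobInfty W K (p ^ M) q) →
      ∀ ℓ : ℕ, ℓ.Prime → ℓ ∣ m → ∀ v : HeightOneSpectrum (𝓞 K), (ℓ : 𝓞 K) ∈ v.asIdeal →
        ∀ a : ℕ, (((p : ℤ) ^ a) • kolyvaginClass (W.baseChange K) _ hdiv (hA m)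
              (j m (kolyvaginPoint (σ m) (L m) (f m) (y m))) (hPt m) ∈
            selmerLocalKer (W.baseChange K) (v.adicCompletion K) ((p ^ M : ℕ) : ℤ) ↔
          ((p : ℤ) ^ a) • kolyvaginClass (W.baseChange K) _ hdiv (hA (m / ℓ))
              (j (m / ℓ) (kolyvaginPoint (σ (m / ℓ)) (L (m / ℓ)) (f (m / ℓ)) (y (m / ℓ))))
              (hPt (m / ℓ)) ∈
            (W.baseChange K).torsionLocalKer (v.adicCompletion K) ((p ^ M : ℕ) : ℤ)) :=
  h44_of_prop37_of_ringClassDecomposition_on_of_supersingular hK hHP hp hM hss hdiv σ L H f hord y π j hj hA hPt hI R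
    h37
    (fun m _ ↦ hsplit_of_ringClassField (N := N) (p := p) (M := M) hK ι σ L H f y j e
      (hrat_of_galoisDictionary ι σ L H f y π j hj e ρ hρ hπρ) m)
    (hram_of_totallyRamified_on (N := N) (W := W) (p := p) (M := M) hK ι σ π j hj e ρ hρ hπρ R hσρ
      fun m _ ↦ htot_of_classFieldTheory (N := N) (W := W) (p := p) (M := M) hK ι e m)

/-- **`h44` at the divisors of one top level `n`, at SUPERSINGULAR Kolyvagin primes, any prime `p`**
(x11b3's `h44_of_prop37_of_dvd`, `hp2`/`hW` → `hss`). [cite: GrossLMS1991, Prop. 3.7, §3 p. 218 l. 1]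
[cite: McCallumLMS1991, Prop. 4.4, §4 (p. 282 l. 1)] -/
theorem h44_of_prop37_of_dvd_of_supersingular [NeZero N] [W.IsElliptic] [W.IsGloballyMinimal]
    (hK : IsImaginaryQuadratic K) (ι : K →+* ℂ)
    {P : (W.baseChange K).toAffine.Point} (hHP : IsHeegnerPoint N W K P)
    {p M : ℕ} (hp : p.Prime) (hM : 1 ≤ M)
    (hss : ∀ ℓ : ℕ, IsKolyvaginPrime N W K p ℓ → FrobEqFrobInfty W K (p ^ M) ℓ →
      W.frobeniusTrace ℓ = 0)
    (hdiv : ∀ Q : geomPoints (W.baseChange K), ∃ R, ((p ^ M : ℕ) : ℤ) • R = Q)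
    {𝒢 : ℕ → Type*} [∀ m, CommGroup (𝒢 m)] {A₀ : ℕ → Type*} [∀ m, AddCommGroup (A₀ m)]
    [∀ m, DistribMulAction (𝒢 m) (A₀ m)]
    (σ : ∀ m, ℕ → 𝒢 m) (L : ℕ → Finset ℕ) (H : ∀ m, Subgroup (𝒢 m))
    [∀ m, Fintype (𝒢 m ⧸ H m)] (f : ∀ m, 𝒢 m ⧸ H m → 𝒢 m)
    (hord : ∀ m, ∀ ℓ ∈ L m, σ m ℓ ^ (ℓ + 1) = 1)
    (y : ∀ m, A₀ m)
    (π : ∀ m, absoluteGaloisGroup K →* 𝒢 m) (j : ∀ m, A₀ m →+ geomPoints (W.baseChange K))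
    (hj : ∀ m (g : absoluteGaloisGroup K) (a : A₀ m), j m (π m g • a) = g • j m a)
    (hA : ∀ m, IsAdmissible (absoluteGaloisGroup K) (j m).range ((p ^ M : ℕ) : ℤ))
    (hPt : ∀ m, j m (kolyvaginPoint (σ m) (L m) (f m) (y m)) ∈
      invPoints (absoluteGaloisGroup K) (j m).range ((p ^ M : ℕ) : ℤ))
    (hI : ∀ m : ℕ, ∀ v : HeightOneSpectrum (𝓞 K), (m : 𝓞 K) ∉ v.asIdeal →
      ∀ 𝔐 ∈ v.localPrimesAbove, ∀ t ∈ 𝔐.inertia (absoluteGaloisGroup (v.adicCompletion K)),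
        resGal (K := K) (v.adicCompletion K) t • j m (kolyvaginPoint (σ m) (L m) (f m) (y m)) =
          j m (kolyvaginPoint (σ m) (L m) (f m) (y m)))
    {n : ℕ}
    (h37 : ∀ m : ℕ, m ∣ n → Squarefree m →
      (∀ q ∈ m.primeFactors, IsKolyvaginPrime N W K p q ∧ FrobEqFrobInfty W K (p ^ M) q) →
      ∀ ℓ : ℕ, ℓ.Prime → ℓ ∣ m →
      ℓ ∈ L m ∧ ∃ y' : A₀ m,
        j m (kolyvaginPoint (σ m) ((L m).erase ℓ) (f m) y') =
          j (m / ℓ) (kolyvaginPoint (σ (m / ℓ)) (L (m / ℓ)) (f (m / ℓ)) (y (m / ℓ))) ∧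
        grAct (A₀ m) (traceElt (σ m ℓ) ℓ) (y m) = W.frobeniusTrace ℓ • y' ∧
        ∀ [Fact ℓ.Prime] (hΔ : ¬ (ℓ : ℤ) ∣ minimalDiscriminantInt W)
          (φ₀ : absoluteGaloisGroup (ZMod ℓ)), (∀ x : AlgebraicClosure (ZMod ℓ), φ₀ • x = x ^ ℓ) →
          ∀ γ : 𝒢 m, geomReduction hΔ ((RatClosure.pointsEquiv (K := K) W).symm (j m (γ • y m))) =
            φ₀ • geomReduction hΔ ((RatClosure.pointsEquiv (K := K) W).symm (j m (γ • y'))))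
    (e : ∀ m, ringClassField K ι m →ₐ[K] AlgebraicClosure K)
    (ρ : ∀ m, 𝒢 m →* (ringClassField K ι m ≃ₐ[ℚ] ringClassField K ι m))
    (hρ : ∀ m, Function.Injective (ρ m))
    (hπρ : ∀ m (τ : absoluteGaloisGroup K) (x : ringClassField K ι m),
      τ • e m x = e m (ρ m (π m τ) x))
    (hσρ : ∀ m : ℕ, m ∣ n → ∀ ℓ ∈ m.primeFactors,
      (Subgroup.zpowers (σ m ℓ)).map (ρ m) = ringClassGalOver ι m (m / ℓ)) :
    ∀ m : ℕ, m ∣ n → Squarefree m →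
      (∀ q ∈ m.primeFactors, IsKolyvaginPrime N W K p q ∧ FrobEqFrobInfty W K (p ^ M) q) →
      ∀ ℓ : ℕ, ℓ.Prime → ℓ ∣ m → ∀ v : HeightOneSpectrum (𝓞 K), (ℓ : 𝓞 K) ∈ v.asIdeal →
        ∀ a : ℕ, (((p : ℤ) ^ a) • kolyvaginClass (W.baseChange K) _ hdiv (hA m)
              (j m (kolyvaginPoint (σ m) (L m) (f m) (y m))) (hPt m) ∈
            selmerLocalKer (W.baseChange K) (v.adicCompletion K) ((p ^ M : ℕ) : ℤ) ↔
          ((p : ℤ) ^ a) • kolyvaginClass (W.baseChange K) _ hdiv (hA (m / ℓ))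
              (j (m / ℓ) (kolyvaginPoint (σ (m / ℓ)) (L (m / ℓ)) (f (m / ℓ)) (y (m / ℓ))))
              (hPt (m / ℓ)) ∈
            (W.baseChange K).torsionLocalKer (v.adicCompletion K) ((p ^ M : ℕ) : ℤ)) :=
  h44_of_prop37_on_of_supersingular hK ι hHP hp hM hss hdiv σ L H f hord y π j hj hA hPt hI (· ∣ n) h37 e ρ hρ hπρ
    hσρ

end Summit.BirchSwinnertonDyer.BirchSwinnertonDyer.Theorems.SylvesterTwoUpper

end
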